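import Mathlib
import Literature.MathematicalPhysics.QuantumFieldTheory.IsingGaugeRandomCurrents
import Literature.MathematicalPhysics.QuantumFieldTheory.PottsGaugeWilsonLoopRectangleArea
import HarnessLib

/-!
# Ising lattice gauge theory in the random-current normalisation IS `2`-state Potts gauge theory at
# `β_Potts = 4β`: the dictionary, and the FK-route results in the normalisation of
# [ForsstromViklund2025currents] — PROVED on the torus

Companion of `IsingGaugeRandomCurrents` (Ising lattice gauge theory with weight
`e^{-βS(σ)} = ∏_{p ∈ C₂⁺} e^{2βρ(dσ(p))}`, `Z_β[γ]`, `𝔼_β[W_γ] = Z_β[γ]/Z_β[0]`, reading R2 there) and of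
the plaquette random-cluster files (`PottsGaugeEdwardsSokal`: `q`-state Potts gauge theory with
weight `e^{β #flat plaquettes}`, `pottsExpect`; `PottsGaugeWilsonLoopPercolationBounds`,
`PottsGaugeWilsonLoopAreaLaw`, `PottsGaugeWilsonLoopRectangleArea`).

* M. P. Forsström, F. Viklund, arXiv:2502.19942 [ForsstromViklund2025currents], eq. (1.7)
  (`𝔼_{N,β}[W_γ] = φ⁰_{B_N,1-e^{-4β}}(𝒫_γ)`), Prop. 6.2 (`𝔼[W_γ] > 0`), Prop. 6.5 (area law
  `𝔼_{N,β}[W_γ] ≤ (4(m-1)β)^{area(γ)}/(1-4(m-1)β)`), Prop. 6.6 (`Ψ_{tanh 2β} ≤ φ⁰ ≤ Ψ_{1-e^{-4β}}`)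
  [corpus:paper:arxiv-2502.19942 p0005, p0010–p0011].
* P. Duncan, B. Schweinhart, CMP **406** (2025) [DuncanSchweinhart2025], §1.1 Defs. 2–3, Thm. 5.

## Scope (read this first)

Gauge group `ℤ₂` only, finite torus. Nothing here bears on the Yang–Mills mass gap or on
`BalabanLadder.IR`; in the `ym` ladder only the conditional finite-`𝕋⁴` rung `BalabanLadder.UV` is
closed by any route. The point of the file is bookkeeping for the `ym-ir` census row A9: the census
records "(1.7) = Duncan–Schweinhart Thm 5 with `q = 2`, `β_Potts = 4β_Wilson`"; this is typed here, so
that every FK-route theorem about `pottsExpect (ZMod 2) (4β)` is literally a theorem about the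
Forsström–Viklund expectation `Z_β[γ]/Z_β[0]`.

## What is typed (everything PROVED; no named fact)

* `stdAddChar_two` (`e(x) = ρ(x) ∈ {±1}` on `ℤ₂`), `wilsonSign_eq_re_wilsonLoopVar` (`W_γ = Re e(σ(γ))`),
  `sum_plaqSpin_eq` (`Σ_p ρ(dσ(p)) = 2 #flat - |C₂⁺|`), `boltzmann_eq_pottsWeight`
  (`e^{-βS(σ)} = e^{-2β|C₂⁺|} e^{4β #flat}`), **`wilsonExpect_eq_pottsExpect`**
  (`Z_β[γ]/Z_β[0] = Re 𝔼_{ν_{4β}} W_γ`, Potts gauge theory with `q = 2` at `β_Potts = 4β`);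
* consequences for `β > 0`, on `𝕋^d_L`: **`wilsonExpect_sandwich`** (FV (1.7) + Prop. 6.6:
  `ψ_{tanh 2β}(V_γ) ≤ 𝔼_β[W_γ] ≤ ψ_{1-e^{-4β}}(V_γ)`, with exactly the printed parameters),
  `wilsonExpect_pos` (Prop. 6.2, `> 0`, for boundaries `γ = ∂c`), `wilsonExpect_le_areaLaw`
  (Prop. 6.5-type area law `𝔼_β[W_γ] ≤ (8(d-1)β)^{area(γ)}/(1 - 8(d-1)β)` for `8(d-1)β < 1` — the FK
  constant, twice the printed `4(m-1)β`, as flagged in `PottsGaugeWilsonLoopAreaLaw`),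
  `wilsonExpect_mono` (Prop. 6.3(ii): monotone in `β`), `wilsonExpect_rect_supermul` (Cor. 6.4's
  finite-volume core: supermultiplicativity of rectangular loops in the side length).
-/

open Finset

namespace Literature.MathematicalPhysics.QuantumFieldTheory

namespace IsingGaugeCurrents

open LatticeForm PlaquetteRC

variable {d L : ℕ} [NeZero L]

/-! ### `ℤ₂` characters: `e(x) = ρ(x)` -/

/-- On `ℤ₂` the standard additive character is the sign representation: `e(x) = e^{πi x} = ρ(x)`.
[cite: ForsstromViklund2025currents, §1.1 (ρ the natural representation of ℤ₂)] -/
theorem stdAddChar_two (x : ZMod 2) : (ZMod.stdAddChar x : ℂ) = (spin x : ℂ) := by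
  have hx : x = 0 ∨ x = 1 := by decide +revert
  rcases hx with rfl | rfl
  · rw [AddChar.map_zero_eq_one]
    simp [spin]
  · have h1 : (1 : ZMod 2) = ((1 : ℤ) : ZMod 2) := by simp
    rw [h1, ZMod.stdAddChar_coe]
    have h2 : (2 * Real.pi * Complex.I * ((1 : ℤ) : ℂ) / ((2 : ℕ) : ℂ) : ℂ) = Real.pi * Complex.I := by
      push_cast
      ring
    rw [h2, Complex.exp_pi_mul_I]
    simp [spin]

/-- **`W_γ(σ) = Re e(σ(γ))`**: the Forsström–Viklund Wilson loop variable is the real part of the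
Duncan–Schweinhart one for `q = 2` (both are `±1`). [cite: ForsstromViklund2025currents, §1.1 (W_γ); DuncanSchweinhart2025, §1.1 Def. 3] -/
theorem wilsonSign_eq_re_wilsonLoopVar (γ θ : Site d L → Fin d → ZMod 2) :
    wilsonSign γ θ = (wilsonLoopVar 2 γ θ).re := by
  rw [wilsonSign, wilsonLoopVar, stdAddChar_two, Complex.ofReal_re]

/-- `Σ_p ρ(dσ(p)) = 2 #{flat plaquettes} - |C₂⁺|`. [cite: ForsstromViklund2025currents, §1.1 (S(σ)); DuncanSchweinhart2025, §1.1 Def. 2 (H = -#flat)] -/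
theorem sum_plaqSpin_eq (θ : Site d L → Fin d → ZMod 2) :
    ∑ p : Plaquette d L, plaqSpin θ p =
      2 * (flatCount (ZMod 2) θ : ℝ) - Fintype.card (Plaquette d L) := by
  classical
  unfold plaqSpin spin flatCount
  rw [Finset.sum_ite, Finset.sum_const, Finset.sum_const, nsmul_eq_mul, nsmul_eq_mul, mul_one,
    mul_neg, mul_one]
  have h := Finset.card_filter_add_card_filter_not (s := (Finset.univ : Finset (Plaquette d L)))
    (fun p => res (td₁ θ) p = 0)
  rw [Finset.card_univ] at h
  have h' : (((Finset.univ.filter fun p : Plaquette d L => ¬res (td₁ θ) p = 0).card : ℕ) : ℝ) =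
      Fintype.card (Plaquette d L) - ((Finset.univ.filter fun p : Plaquette d L => res (td₁ θ) p = 0).card : ℝ) := by
    rw [eq_sub_iff_add_eq', ← Nat.cast_add, h]
  rw [h']
  ring

/-- **The weights agree up to a constant**: `e^{-βS(σ)} = e^{-2β|C₂⁺|} · e^{4β #flat(σ)}`, i.e. the
Ising lattice gauge weight at `β` is the `2`-state Potts gauge weight at `β_Potts = 4β`.
[cite: ForsstromViklund2025currents, eq. (1.7) ("φ⁰_{B_N,1-e^{-4β}}")] -/
theorem boltzmann_eq_pottsWeight (β : ℝ) (θ : Site d L → Fin d → ZMod 2) :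
    boltzmann β θ =
      Real.exp (-(2 * β * Fintype.card (Plaquette d L))) * pottsWeight (ZMod 2) (4 * β) θ := by
  rw [boltzmann, isingAction, sum_plaqSpin_eq, pottsWeight_eq, ← Real.exp_add]
  congr 1
  ring

/-- **The dictionary**: `𝔼_{β}[W_γ] = Z_β[γ]/Z_β[0] = Re 𝔼_{ν_{4β}, q=2} W_γ` — the Ising lattice gauge
expectation of [ForsstromViklund2025currents] is the `2`-state Potts lattice gauge expectation of
[DuncanSchweinhart2025] at `β_Potts = 4β` ("(1.7) = Theorem 5 with `q = 2`").
[cite: ForsstromViklund2025currents, eq. (1.7); DuncanSchweinhart2025, Thm. 5] -/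
theorem wilsonExpect_eq_pottsExpect (β : ℝ) (γ : Site d L → Fin d → ZMod 2) :
    loopNumerator β γ / loopNumerator (d := d) (L := L) β 0 =
      (pottsExpect (d := d) (L := L) (ZMod 2) (4 * β) (wilsonLoopVar 2 γ)).re := by
  set E : ℝ := Real.exp (-(2 * β * Fintype.card (Plaquette d L))) with hE
  have hE0 : E ≠ 0 := (Real.exp_pos _).ne'
  have hnum : loopNumerator β γ =
      E * ∑ θ : Site d L → Fin d → ZMod 2, wilsonSign γ θ * pottsWeight (ZMod 2) (4 * β) θ := by
    unfold loopNumerator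
    rw [Finset.mul_sum]
    refine Finset.sum_congr rfl fun θ _ => ?_
    rw [boltzmann_eq_pottsWeight]
    ring
  have hden : loopNumerator (d := d) (L := L) β 0 =
      E * pottsPartitionFn (d := d) (L := L) (ZMod 2) (4 * β) := by
    unfold loopNumerator pottsPartitionFn
    rw [Finset.mul_sum]
    refine Finset.sum_congr rfl fun θ _ => ?_
    have h1 : wilsonSign (0 : Site d L → Fin d → ZMod 2) θ = 1 := by simp [wilsonSign, pairing, spin]
    rw [h1, one_mul, boltzmann_eq_pottsWeight]
  rw [hnum, hden, mul_div_mul_left _ _ hE0]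
  unfold pottsExpect pottsProb
  rw [Complex.re_sum, Finset.sum_div]
  refine Finset.sum_congr rfl fun θ _ => ?_
  rw [Complex.re_ofReal_mul, ← wilsonSign_eq_re_wilsonLoopVar]
  ring

/-! ### The FK-route results in the Forsström–Viklund normalisation -/

/-- **[ForsstromViklund2025currents, (1.7) + Prop. 6.6] on the torus, with the printed parameters**:
for `β > 0` and every `ℤ₂` `1`-chain `γ`, `ψ_{tanh 2β}(V_γ) ≤ 𝔼_β[W_γ] ≤ ψ_{1-e^{-4β}}(V_γ)`,
`ψ_r` Bernoulli plaquette percolation, `V_γ` = "`γ` bounds a `ℤ₂` surface of open plaquettes".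
[cite: ForsstromViklund2025currents, eq. (1.7) and Prop. 6.6] -/
theorem wilsonExpect_sandwich {β : ℝ} (hβ : 0 < β) (γ : Site d L → Fin d → ZMod 2) :
    eventProb (d := d) (L := L) (ZMod 2) (Real.tanh (2 * β)) 1 {ω | IsNullHomologousIn ω γ} ≤
        loopNumerator β γ / loopNumerator (d := d) (L := L) β 0 ∧
      loopNumerator β γ / loopNumerator (d := d) (L := L) β 0 ≤
        eventProb (d := d) (L := L) (ZMod 2) (1 - Real.exp (-(4 * β))) 1 {ω | IsNullHomologousIn ω γ} := by
  have h := wilsonLoop_percolation_sandwich_two (d := d) (L := L) (by linarith : 0 < 4 * β) γ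
  rw [wilsonExpect_eq_pottsExpect]
  have h1 : 4 * β / 2 = 2 * β := by ring
  rw [h1] at h
  exact ⟨h.1, by simpa [esParam] using h.2⟩

/-- **[ForsstromViklund2025currents, Prop. 6.2] on the torus, strict form for boundaries**: for
`β > 0` and every plaquette `2`-chain `c`, `𝔼_β[W_{∂c}] > 0`. [cite: ForsstromViklund2025currents, Prop. 6.2] -/
theorem wilsonExpect_pos {β : ℝ} (hβ : 0 < β) (c : Plaquette d L → ZMod 2) :
    0 < loopNumerator β (bd₂ c) / loopNumerator (d := d) (L := L) β 0 := by
  rw [wilsonExpect_eq_pottsExpect]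
  exact pottsExpect_wilsonLoopVar_re_pos 2 (by linarith) c

/-- **[ForsstromViklund2025currents, Prop. 6.5]-type area law on the torus, FK constant**: for
`0 < β` with `8(d-1)β < 1` and every `ℤ₂` `1`-chain `γ`,
`𝔼_β[W_γ] ≤ (8(d-1)β)^{area(γ)} / (1 - 8(d-1)β)` (`area` the least number of plaquettes of a
spanning `ℤ₂` surface; the printed constant is `4(m-1)β`, see `PottsGaugeWilsonLoopAreaLaw`).
[cite: ForsstromViklund2025currents, Prop. 6.5] -/
theorem wilsonExpect_le_areaLaw {β : ℝ} (hβ : 0 < β) (hκ : (8 * (d - 1 : ℕ) : ℝ) * β < 1)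
    (γ : Site d L → Fin d → ZMod 2) :
    loopNumerator β γ / loopNumerator (d := d) (L := L) β 0 ≤
      ((8 * (d - 1 : ℕ) : ℝ) * β) ^ area γ / (1 - (8 * (d - 1 : ℕ) : ℝ) * β) := by
  rw [wilsonExpect_eq_pottsExpect]
  have hconst : (peierlsConst (ZMod 2) d : ℝ) * (4 * β) = (8 * (d - 1 : ℕ) : ℝ) * β := by
    rw [peierlsConst_zmod]
    push_cast
    ring
  have h := pottsExpect_wilsonLoopVar_re_le_areaLaw' (d := d) (L := L) 2 (by linarith : 0 < 4 * β)
    (by rw [hconst]; exact hκ) γ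
  rwa [hconst] at h

/-- **[ForsstromViklund2025currents, Prop. 6.3(ii)] on the torus** (`d/dβ 𝔼_β[W_γ] ≥ 0`, as
monotonicity): `0 < β₁ ≤ β₂ ⇒ 𝔼_{β₁}[W_γ] ≤ 𝔼_{β₂}[W_γ]` — here by the FK route (comparison in `p`);
the random-current route is `wilsonExpect_mul_le` of `IsingGaugeSwitchingLemma`.
[cite: ForsstromViklund2025currents, Prop. 6.3] -/
theorem wilsonExpect_mono {β₁ β₂ : ℝ} (hβ₁ : 0 < β₁) (h12 : β₁ ≤ β₂) (γ : Site d L → Fin d → ZMod 2) :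
    loopNumerator β₁ γ / loopNumerator (d := d) (L := L) β₁ 0 ≤
      loopNumerator β₂ γ / loopNumerator (d := d) (L := L) β₂ 0 := by
  rw [wilsonExpect_eq_pottsExpect, wilsonExpect_eq_pottsExpect]
  exact pottsExpect_wilsonLoopVar_re_mono 2 (by linarith) (by linarith) γ

/-- **[ForsstromViklund2025currents, Cor. 6.4], finite-volume core on the torus, in the printed
normalisation**: for `β > 0` and `T + T' ≤ L`, rectangular Wilson loops are supermultiplicative in
the side length, `𝔼_β[W_{R×(T+T')}] ≥ 𝔼_β[W_{R×T}] 𝔼_β[W_{R×T'}]` (so `T ↦ -log 𝔼_β[W_{γ_{R,T}}]` is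
subadditive; the Fekete limit defining `V_β(R)` needs the infinite volume and is not typed).
[cite: ForsstromViklund2025currents, Cor. 6.4] -/
theorem wilsonExpect_rect_supermul {β : ℝ} (hβ : 0 < β) (x₀ : Site d L) {i j : Fin d} (hij : i < j)
    (Rr T T' : ℕ) (h : T + T' ≤ L) :
    loopNumerator β (bd₂ (rectChain (R := ZMod 2) x₀ hij Rr T)) / loopNumerator (d := d) (L := L) β 0 *
        (loopNumerator β (bd₂ (rectChain (R := ZMod 2) x₀ hij Rr T')) /
          loopNumerator (d := d) (L := L) β 0) ≤
      loopNumerator β (bd₂ (rectChain (R := ZMod 2) x₀ hij Rr (T + T'))) /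
        loopNumerator (d := d) (L := L) β 0 := by
  rw [wilsonExpect_eq_pottsExpect, wilsonExpect_eq_pottsExpect, wilsonExpect_eq_pottsExpect]
  exact pottsExpect_wilsonLoop_rect_supermul 2 (by linarith) x₀ hij Rr T T' h

end IsingGaugeCurrents

end Literature.MathematicalPhysics.QuantumFieldTheory
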